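import Mathlib
import Summits.ValiantsHypothesis.ValiantsHypothesis.Theorems.FifoMatchingNNLinearDegreeCofactorHardQueueLineage
import HarnessLib

/-!
# Crux `NNLinearDegreeCofactorHard` (stmt-ValiantsHypothesis-23918), line `internal_cofactor`: GENEALOGY of colour
# boundaries restricted to a class of items (the S-items of μ* = `shedWord`; piece (D*-1) of LEAD-HANDOFF §p2)

`…QueueLineage.card_boundaries_pushed_le` counts boundaries between CONSECUTIVE items.  Under μ* the items pushed at defect
positions (R-items) carry free colours and must be ignored: the lineage that matters is that of the S-ITEMS (a Boolean
predicate `isS` on item indices), and the S-PREDECESSOR `Nat.findGreatest isS (k − 1)` replaces `k − 1`.  The hypothesis is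
the μ* dictionary: a push at a time in `[a,b)` that creates an S-item and is not a test has an S-item as its front and agrees
with it in colour (`ShedWord.isDefect_frontPos_eq_false_of_push`: R-fronts are shed, never copied).

* `isS_spred`, `spred_lt_spred` — the S-predecessor of an index above an S-item is an S-item in between, monotonically;
* `exists_sboundary_between` — intermediate value along the S-items: two S-items `i < j` of different colours have an
  S-item `j' ∈ (i, j]` whose colour differs from its S-predecessor's (which is `≥ i`);
* `card_sboundaries_pushed_le` — **S-genealogy**: the S-items `k` pushed during `[a,b)` whose S-predecessor is an S-item
  also pushed during `[a,b)` and has another colour number at most the S-items `j ∈ (rC a, rC b]` differing in colour from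
  their S-predecessor, plus `2·#tests`.  So S-blocks never multiply without tests, whatever the R-items do.

Honest framing: deterministic bookkeeping; nothing here proves (D*), S2b, the crux or VP ≠ VNP.  No definitions
(`Nat.findGreatest` inline), no named facts.
-/

-- Sub = Summit single-conjunct layout: the duplicated namespace component is mandated by the tree.
set_option linter.dupNamespace false

namespace Summit.ValiantsHypothesis.ValiantsHypothesis.Theorems.FifoMatching.NNLinearDegreeCofactorHard.QueueHistory

open Finset
open Summit.ValiantsHypothesis.ValiantsHypothesis.Theorems.FifoMatching.NNMonotoneHard

/-! ### The S-predecessor -/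

/-- The S-predecessor `Nat.findGreatest isS (k-1)` of an index `k` above an S-item `i < k` is an S-item in `[i, k)`.
[folklore] -/
theorem isS_spred (isS : ℕ → Bool) {i k : ℕ} (hi : isS i = true) (hik : i < k) :
    isS (Nat.findGreatest (fun n => isS n = true) (k - 1)) = true ∧
      i ≤ Nat.findGreatest (fun n => isS n = true) (k - 1) ∧ Nat.findGreatest (fun n => isS n = true) (k - 1) < k :=
  ⟨Nat.findGreatest_spec (P := fun n => isS n = true) (by omega) hi,
    Nat.le_findGreatest (P := fun n => isS n = true) (by omega) hi,
    lt_of_le_of_lt (Nat.findGreatest_le (k - 1)) (by omega)⟩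

/-- Strict monotonicity of the S-predecessor across an S-item: `spred k₁ < k₁ ≤ spred k₂` for an S-item `k₁ < k₂`
(`k₁ ≥ 1`). [folklore] -/
theorem spred_lt_spred (isS : ℕ → Bool) {k₁ k₂ : ℕ} (h₁ : isS k₁ = true) (hk₁ : 1 ≤ k₁) (hlt : k₁ < k₂) :
    Nat.findGreatest (fun n => isS n = true) (k₁ - 1) < Nat.findGreatest (fun n => isS n = true) (k₂ - 1) :=
  lt_of_lt_of_le (lt_of_le_of_lt (Nat.findGreatest_le (k₁ - 1)) (by omega))
    (Nat.le_findGreatest (P := fun n => isS n = true) (by omega) h₁)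

/-- **Intermediate value along the S-items.**  If `i < j` are S-items with `f i ≠ f j`, some S-item `j' ∈ (i, j]` has
S-predecessor `≥ i` and `f j' ≠ f (spred j')`. [folklore] -/
theorem exists_sboundary_between (isS : ℕ → Bool) (f : ℕ → Bool) {i : ℕ} (hi : isS i = true) :
    ∀ j, i < j → isS j = true → f i ≠ f j →
      ∃ j', i < j' ∧ j' ≤ j ∧ isS j' = true ∧ i ≤ Nat.findGreatest (fun n => isS n = true) (j' - 1) ∧
        f j' ≠ f (Nat.findGreatest (fun n => isS n = true) (j' - 1)) := by
  intro j
  induction j using Nat.strong_induction_on with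
  | _ j ih =>
    intro hij hj hne
    obtain ⟨hS, hle, hlt⟩ := isS_spred isS hi hij
    by_cases hcol : f j = f (Nat.findGreatest (fun n => isS n = true) (j - 1))
    · have hii' : i < Nat.findGreatest (fun n => isS n = true) (j - 1) := by
        rcases eq_or_lt_of_le hle with h | h
        · exact absurd (by rw [h]; exact hcol.symm) hne
        · exact h
      obtain ⟨j', h1, h2, h3, h4, h5⟩ := ih _ hlt hii' hS (by rw [← hcol]; exact hne)
      exact ⟨j', h1, by omega, h3, h4, h5⟩
    · exact ⟨j, hij, le_rfl, hj, hle, hcol⟩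

section AbstractQueue

variable {W σ : ℕ → Bool} {rO rC o c : ℕ → ℕ} {n' : ℕ}
variable (hOs : ∀ t, rO (t + 1) = rO t + (if W t = true then 1 else 0))
  (hCs : ∀ t, rC (t + 1) = rC t + (if W t = true then 0 else 1))
  (ho : ∀ k t, k < n' → (o k < t ↔ k < rO t))

include hOs hCs ho in
/-- **S-genealogy of colour boundaries.**  Let `isS` mark a class of items and let `Tests ⊇` the push times `t ∈ [a,b)`
creating an S-item (`isS (rO t)`) at which the front is not an S-item or has another colour.  Then the S-items `k` pushed
during `[a,b)` (`rO a < k < rO b`) whose S-predecessor is an S-item `≥ rO a` of another colour number at most the S-items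
`j ∈ (rC a, rC b]` whose colour differs from their S-predecessor's, plus `2·#Tests`. [folklore] -/
theorem card_sboundaries_pushed_le (isS : ℕ → Bool) {a b : ℕ} (hn : rO b ≤ n') (Tests : Finset ℕ)
    (hTests : ∀ t, a ≤ t → t < b → W t = true → isS (rO t) = true →
      (isS (rC t) = false ∨ σ t ≠ σ (o (rC t))) → t ∈ Tests) :
    ((Ico (rO a + 1) (rO b)).filter fun k => isS k = true ∧
        isS (Nat.findGreatest (fun n => isS n = true) (k - 1)) = true ∧
        rO a ≤ Nat.findGreatest (fun n => isS n = true) (k - 1) ∧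
        σ (o k) ≠ σ (o (Nat.findGreatest (fun n => isS n = true) (k - 1)))).card
      ≤ ((Ioc (rC a) (rC b)).filter fun j => isS j = true ∧
          σ (o j) ≠ σ (o (Nat.findGreatest (fun n => isS n = true) (j - 1)))).card + 2 * Tests.card := by
  classical
  have hmonoC : ∀ {s t : ℕ}, s ≤ t → rC s ≤ rC t := fun h => rankC_mono hCs h
  set sp : ℕ → ℕ := fun k => Nat.findGreatest (fun n => isS n = true) (k - 1) with hsp
  set S := (Ico (rO a + 1) (rO b)).filter fun k => isS k = true ∧ isS (sp k) = true ∧ rO a ≤ sp k ∧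
    σ (o k) ≠ σ (o (sp k)) with hS
  show S.card ≤ _
  have hitem : ∀ k ∈ S, rO a + 1 ≤ k ∧ k < rO b ∧ isS k = true ∧ isS (sp k) = true ∧ rO a ≤ sp k ∧
      σ (o k) ≠ σ (o (sp k)) := by
    intro k hk
    rw [hS, mem_filter, mem_Ico] at hk
    exact ⟨hk.1.1, hk.1.2, hk.2.1, hk.2.2.1, hk.2.2.2.1, hk.2.2.2.2⟩
  have hkn : ∀ k ∈ S, k < n' := fun k hk => lt_of_lt_of_le (hitem k hk).2.1 hn
  have hsp_lt : ∀ k ∈ S, sp k < k := fun k hk =>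
    lt_of_le_of_lt (Nat.findGreatest_le (k - 1)) (by have := (hitem k hk).1; omega)
  have hpush : ∀ k, rO a ≤ k → k < rO b → a ≤ o k ∧ o k < b := by
    intro k h1 h2
    have hk : k < n' := lt_of_lt_of_le h2 hn
    constructor
    · by_contra hlt
      push Not at hlt
      have := (ho k a hk).1 hlt
      omega
    · exact (ho k b hk).2 h2
  -- split off the items touched by a test
  set St := S.filter fun k => o k ∈ Tests ∨ o (sp k) ∈ Tests with hSt
  set Sf := S.filter fun k => ¬ (o k ∈ Tests ∨ o (sp k) ∈ Tests) with hSf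
  have hsplit : S.card = St.card + Sf.card := by
    rw [hSt, hSf, card_filter_add_card_filter_not]
  -- (1) two injections into `Tests`
  have hSt_le : St.card ≤ 2 * Tests.card := by
    set S₁ := S.filter fun k => o k ∈ Tests with hS₁
    set S₂ := S.filter fun k => o (sp k) ∈ Tests with hS₂
    have hsub : St ⊆ S₁ ∪ S₂ := by
      intro k hk
      rw [hSt, mem_filter] at hk
      rw [mem_union]
      rcases hk.2 with h | h
      · left; rw [hS₁]; exact mem_filter.2 ⟨hk.1, h⟩
      · right; rw [hS₂]; exact mem_filter.2 ⟨hk.1, h⟩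
    have h1 : S₁.card ≤ Tests.card := by
      refine Finset.card_le_card_of_injOn o (fun k hk => ?_) ?_
      · exact (mem_filter.1 hk).2
      · intro k₁ hk₁ k₂ hk₂ h
        have hk₁' := hkn k₁ (mem_filter.1 hk₁).1
        have hk₂' := hkn k₂ (mem_filter.1 hk₂).1
        by_contra hne
        rcases lt_or_gt_of_ne hne with hlt | hlt
        · exact absurd h (ne_of_lt ((opener_lt_opener_iff hOs ho hk₁' hk₂').2 hlt))
        · exact absurd h.symm (ne_of_lt ((opener_lt_opener_iff hOs ho hk₂' hk₁').2 hlt))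
    have h2 : S₂.card ≤ Tests.card := by
      refine Finset.card_le_card_of_injOn (fun k => o (sp k)) (fun k hk => ?_) ?_
      · exact (mem_filter.1 hk).2
      · intro k₁ hk₁ k₂ hk₂ h
        have hS₁ := (mem_filter.1 hk₁).1
        have hS₂ := (mem_filter.1 hk₂).1
        have hp₁ : sp k₁ < n' := (hsp_lt k₁ hS₁).trans (hkn k₁ hS₁)
        have hp₂ : sp k₂ < n' := (hsp_lt k₂ hS₂).trans (hkn k₂ hS₂)
        by_contra hne
        rcases lt_or_gt_of_ne hne with hlt | hlt
        · have := spred_lt_spred isS (hitem k₁ hS₁).2.2.1 (by have := (hitem k₁ hS₁).1; omega) hlt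
          exact absurd h (ne_of_lt ((opener_lt_opener_iff hOs ho hp₁ hp₂).2 this))
        · have := spred_lt_spred isS (hitem k₂ hS₂).2.2.1 (by have := (hitem k₂ hS₂).1; omega) hlt
          exact absurd h (ne_of_gt ((opener_lt_opener_iff hOs ho hp₂ hp₁).2 this))
    calc St.card ≤ (S₁ ∪ S₂).card := card_le_card hsub
      _ ≤ S₁.card + S₂.card := card_union_le _ _
      _ ≤ Tests.card + Tests.card := Nat.add_le_add h1 h2
      _ = 2 * Tests.card := by ring
  -- (2) test-free items: fronts are S-items and agree
  have hagree : ∀ k ∈ Sf,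
      (isS (rC (o k)) = true ∧ σ (o k) = σ (o (rC (o k)))) ∧
      (isS (rC (o (sp k))) = true ∧ σ (o (sp k)) = σ (o (rC (o (sp k))))) := by
    intro k hk
    rw [hSf, mem_filter] at hk
    obtain ⟨hkS, hnot⟩ := hk
    push Not at hnot
    obtain ⟨h1, h2, hSk, hSp, hap, -⟩ := hitem k hkS
    have hk' := hkn k hkS
    have hp' : sp k < n' := (hsp_lt k hkS).trans hk'
    have hpk := hpush k (by omega) h2
    have hpp := hpush (sp k) hap ((hsp_lt k hkS).trans h2)
    have hrk : rO (o k) = k := (rankO_opener hOs ho hk').1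
    have hrp : rO (o (sp k)) = sp k := (rankO_opener hOs ho hp').1
    constructor
    · by_contra hbad
      have : isS (rC (o k)) = false ∨ σ (o k) ≠ σ (o (rC (o k))) := by
        rcases Bool.eq_false_or_eq_true (isS (rC (o k))) with h | h
        · right; intro heq; exact hbad ⟨h, heq⟩
        · exact Or.inl h
      exact hnot.1 (hTests (o k) hpk.1 hpk.2 (letter_opener hOs ho hk') (by rw [hrk]; exact hSk) this)
    · by_contra hbad
      have : isS (rC (o (sp k))) = false ∨ σ (o (sp k)) ≠ σ (o (rC (o (sp k)))) := by
        rcases Bool.eq_false_or_eq_true (isS (rC (o (sp k)))) with h | h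
        · right; intro heq; exact hbad ⟨h, heq⟩
        · exact Or.inl h
      exact hnot.2 (hTests (o (sp k)) hpp.1 hpp.2 (letter_opener hOs ho hp') (by rw [hrp]; exact hSp) this)
  -- the copied S-boundary
  have hex : ∀ k ∈ Sf, ∃ j', rC (o (sp k)) < j' ∧ j' ≤ rC (o k) ∧ isS j' = true ∧
      σ (o j') ≠ σ (o (sp j')) := by
    intro k hk
    obtain ⟨⟨hSj, hA⟩, ⟨hSi, hB⟩⟩ := hagree k hk
    have hkS : k ∈ S := (mem_filter.1 (by rw [hSf] at hk; exact hk)).1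
    obtain ⟨h1, h2, hSk, hSp, hap, hbd⟩ := hitem k hkS
    have hk' := hkn k hkS
    have hlt : o (sp k) < o k := (opener_lt_opener_iff hOs ho ((hsp_lt k hkS).trans hk') hk').2 (hsp_lt k hkS)
    have hle : rC (o (sp k)) ≤ rC (o k) := hmonoC hlt.le
    have hne : σ (o (rC (o (sp k)))) ≠ σ (o (rC (o k))) := by rw [← hA, ← hB]; exact hbd.symm
    rcases eq_or_lt_of_le hle with heq | hlt'
    · exact absurd (by rw [heq]) hne
    · obtain ⟨j', g1, g2, g3, -, g5⟩ := exists_sboundary_between isS (fun i => σ (o i)) hSi _ hlt' hSj hne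
      exact ⟨j', g1, g2, g3, g5⟩
  choose! g hg using hex
  have hSf_le : Sf.card ≤ ((Ioc (rC a) (rC b)).filter fun j => isS j = true ∧ σ (o j) ≠ σ (o (sp j))).card := by
    refine Finset.card_le_card_of_injOn g ?_ ?_
    · intro k hk
      have hk' : k ∈ Sf := hk
      obtain ⟨g1, g2, g3, g4⟩ := hg k hk'
      have hkS : k ∈ S := (mem_filter.1 (by rw [hSf] at hk'; exact hk')).1
      obtain ⟨h1, h2, -, -, hap, -⟩ := hitem k hkS
      have hpk := hpush k (by omega) h2
      have hpp := hpush (sp k) hap ((hsp_lt k hkS).trans h2)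
      rw [mem_coe, mem_filter, mem_Ioc]
      exact ⟨⟨lt_of_le_of_lt (hmonoC hpp.1) g1, g2.trans (hmonoC hpk.2.le)⟩, g3, g4⟩
    · intro k₁ hk₁ k₂ hk₂ hgg
      have hk₁' : k₁ ∈ Sf := hk₁
      have hk₂' : k₂ ∈ Sf := hk₂
      have hS₁ : k₁ ∈ S := (mem_filter.1 (by rw [hSf] at hk₁'; exact hk₁')).1
      have hS₂ : k₂ ∈ S := (mem_filter.1 (by rw [hSf] at hk₂'; exact hk₂')).1
      by_contra hne
      rcases lt_or_gt_of_ne hne with hlt | hlt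
      · -- `g k₁ ≤ rC (o k₁) ≤ rC (o (sp k₂)) < g k₂`
        have h1 := (hg k₁ hk₁').2.1
        have h2 := (hg k₂ hk₂').1
        have hle : k₁ ≤ sp k₂ :=
          Nat.le_findGreatest (P := fun n => isS n = true) (by omega) (hitem k₁ hS₁).2.2.1
        have hmono : rC (o k₁) ≤ rC (o (sp k₂)) := by
          rcases eq_or_lt_of_le hle with heq | hlt2
          · rw [← heq]
          · exact hmonoC ((opener_lt_opener_iff hOs ho (hkn k₁ hS₁)
              ((hsp_lt k₂ hS₂).trans (hkn k₂ hS₂))).2 hlt2).le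
        omega
      · have h1 := (hg k₂ hk₂').2.1
        have h2 := (hg k₁ hk₁').1
        have hle : k₂ ≤ sp k₁ :=
          Nat.le_findGreatest (P := fun n => isS n = true) (by omega) (hitem k₂ hS₂).2.2.1
        have hmono : rC (o k₂) ≤ rC (o (sp k₁)) := by
          rcases eq_or_lt_of_le hle with heq | hlt2
          · rw [← heq]
          · exact hmonoC ((opener_lt_opener_iff hOs ho (hkn k₂ hS₂)
              ((hsp_lt k₁ hS₁).trans (hkn k₁ hS₁))).2 hlt2).le
        omega
  rw [hsplit]
  simp only [hsp] at hSf_le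
  omega

end AbstractQueue

end Summit.ValiantsHypothesis.ValiantsHypothesis.Theorems.FifoMatching.NNLinearDegreeCofactorHard.QueueHistory
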